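import Summits.ABC.ABC.Theses.LopsidedSzpiroSplit

/-!
# Strategy census companion — crux stmt-ABC-18360 `LopsidedABC` (crux-strategist s1, 2026-08-17)

Lean companion of `Cruxes/LopsidedABC/STRATEGY-CENSUS.md`.  Sorry-free; imports only the route file.

## §1 The registered line's load-bearing stub IS the crux (min-breeding absorption)

The birth line (`Lines/birth.lean`, registered skeleton sha 2a0e3e4c…) cuts the crux along
`ω(c·max(a,b))`: `stub_fewPrimeCoincidence` (each cell `≤ k`, constant `K(k,ε)`) and
`stub_manyPrimeCoincidence` (`∃ k₀`, the cell `> k₀`).  Its card and the skeleton vet (`SKELVET.md`)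
argue that the cut is genuine because `ω(c·max)` is invariant under the power maps
`(Mʲ, cʲ − Mʲ, cʲ)` (breeding on the MAX).  Breeding on the MIN is not considered there:

  `τ(m, M, c) := (m², M·(m + c), c²)`,   `m² + M(m+c) = c²`,

keeps `m²` the minimum, preserves lopsidedness EXACTLY (`m ≤ c^(1-ε) ⟺ m² ≤ (c²)^(1-ε)`), multiplies
the radical by at most `m + c ≤ 2c`, and puts the primes of `m + c` into the new maximum.  From the second
application on, `m` and `c` are coprime perfect squares, so `m + c ≡ 1, 2 (mod 4)`, `m + c ≥ 5`, hence
`m + c` has an ODD prime factor, which divides neither `c` nor `M = c − m`: `ω(c·max)` goes up by at least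
one at every step after the first.  Breeding a lopsided triple `k + 1` times therefore lands it in the cell
`ω(c·max) > k` at the cost of replacing `ε` by `ε' = ε / (1 + (1+ε)(2^(k+1) − 1))`, and

  `theorem lopsided_of_manyPrimeAt (k) : ManyPrimeAt k → LopsidedABC`
  `theorem registeredStubMany_iff_crux : (∃ k, ManyPrimeAt k) ↔ LopsidedABC`

(`ManyPrimeAt k` unfolds to the registered statement of `stub_manyPrimeCoincidence` at threshold `k`).
So the birth skeleton's "load-bearing half" is the crux itself and `stub_fewPrimeCoincidence` is not
load-bearing for `LopsidedABC_of` — the cut is cosmetic in the sense of BC2(c) (a piece gives X on its own).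

## §2 The honest `ω`-normal form

With the threshold allowed to depend on `ε` the absorption fails (the number of breedings, hence the loss
`2^(k₀(ε')+1)·ε'`, is no longer controlled), and one gets the exact analogue of
`Theorems.DeepRegimeABC.abc_iff_deepRegimeABC_and_boundedOmega`:

  `theorem lopsided_iff_fewPrime_and_manyPrimeTail : LopsidedABC ↔ FewPrime ∧ ManyPrimeTail`,

`FewPrime := ∀ k, FewPrimeAt k` (the registered stub 1, verbatim) and
`ManyPrimeTail := ∀ ε > 0, ∃ k₀, ∃ K > 0, …` (`∃ k₀` moved UNDER `∀ ε`).  Neither half is known to give the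
crux on its own (few: `K(k,ε)` not uniform in `k`, no cheap map lowers `ω(c·max)`; tail: `k₀(ε)` defeats
min-breeding).  This is the re-cut offered to the lead (census § Decomposition, D0′); it has no engine on
the tail half, exactly as `DeepRegimeABC`.

## §3 The `c`-dominance split (census D3), typed

`CDominated` / `CDispersed`: lopsided abc on `{∃ p, p^(v_p c) ≥ c^(1-ε)}` and on its complement; both are
invariant under every radical-controlled breeding we know (all of them send `c ↦ cⁿ`), so neither is
provably the crux; assembly and restrictions are proved.  Recorded as a calibration, not a line (the
dispersed cell is the engine-less core).
-/

-- `Summit.<Summit>.<Problem>`: for the single-conjunct summit `ABC` the duplicate `ABC.ABC` is mandated.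
set_option linter.dupNamespace false

noncomputable section

namespace Summit.ABC.ABC.Cruxes.LopsidedABC.Strategist

open Literature.NumberTheory.DiophantineGeometry UniqueFactorizationMonoid
open Summit.ABC.ABC.Theses.LopsidedSzpiroSplit

/-! ## §0 The pieces -/

/-- Registered stub 1 at level `k`: lopsided abc on the cell `ω(c·max(a,b)) ≤ k`. -/
def FewPrimeAt (k : ℕ) : Prop :=
  ∀ ε : ℝ, 0 < ε → ∃ K : ℝ, 0 < K ∧ ∀ a b c : ℕ, IsABCTriple a b c →
    (c * max a b).primeFactors.card ≤ k → ((min a b : ℕ) : ℝ) ≤ (c : ℝ) ^ (1 - ε) →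
    (c : ℝ) < K * ((rad a b c : ℕ) : ℝ) ^ (1 + ε)

/-- Registered stub 1 (`stub_fewPrimeCoincidence`), verbatim up to unfolding. -/
def FewPrime : Prop := ∀ k : ℕ, FewPrimeAt k

/-- Registered stub 2 at a FIXED threshold `k`: lopsided abc on the cell `ω(c·max(a,b)) > k`. -/
def ManyPrimeAt (k : ℕ) : Prop :=
  ∀ ε : ℝ, 0 < ε → ∃ K : ℝ, 0 < K ∧ ∀ a b c : ℕ, IsABCTriple a b c →
    k < (c * max a b).primeFactors.card → ((min a b : ℕ) : ℝ) ≤ (c : ℝ) ^ (1 - ε) →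
    (c : ℝ) < K * ((rad a b c : ℕ) : ℝ) ^ (1 + ε)

/-- The `ε`-DEPENDENT many-prime tail: `∃ k₀` under `∀ ε` (the honest re-cut of stub 2). -/
def ManyPrimeTail : Prop :=
  ∀ ε : ℝ, 0 < ε → ∃ k : ℕ, ∃ K : ℝ, 0 < K ∧ ∀ a b c : ℕ, IsABCTriple a b c →
    k < (c * max a b).primeFactors.card → ((min a b : ℕ) : ℝ) ≤ (c : ℝ) ^ (1 - ε) →
    (c : ℝ) < K * ((rad a b c : ℕ) : ℝ) ^ (1 + ε)

/-! ### Restrictions: every piece is a consequence of the crux -/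

theorem fewPrimeAt_of_lopsided (h : LopsidedABC) (k : ℕ) : FewPrimeAt k := by
  intro ε hε
  obtain ⟨K, hK, hh⟩ := h ε hε
  exact ⟨K, hK, fun a b c habc _ hlop => hh a b c habc hlop⟩

theorem manyPrimeAt_of_lopsided (h : LopsidedABC) (k : ℕ) : ManyPrimeAt k := by
  intro ε hε
  obtain ⟨K, hK, hh⟩ := h ε hε
  exact ⟨K, hK, fun a b c habc _ hlop => hh a b c habc hlop⟩

theorem manyPrimeTail_of_lopsided (h : LopsidedABC) : ManyPrimeTail := by
  intro ε hε
  obtain ⟨K, hK, hh⟩ := h ε hε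
  exact ⟨0, K, hK, fun a b c habc _ hlop => hh a b c habc hlop⟩

/-! ### §2 The honest normal form `LopsidedABC ↔ FewPrime ∧ ManyPrimeTail` -/

theorem lopsided_of_fewPrime_of_manyPrimeTail (hfew : FewPrime) (htail : ManyPrimeTail) :
    LopsidedABC := by
  intro ε hε
  obtain ⟨k₀, K₂, hK₂, h₂⟩ := htail ε hε
  obtain ⟨K₁, hK₁, h₁⟩ := hfew k₀ ε hε
  refine ⟨max K₁ K₂, lt_max_of_lt_left hK₁, fun a b c habc hlop => ?_⟩
  have hR : 0 ≤ ((rad a b c : ℕ) : ℝ) ^ (1 + ε) := by positivity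
  rcases Nat.lt_or_ge k₀ ((c * max a b).primeFactors.card) with hlt | hle
  · exact (h₂ a b c habc hlt hlop).trans_le (mul_le_mul_of_nonneg_right (le_max_right _ _) hR)
  · exact (h₁ a b c habc hle hlop).trans_le (mul_le_mul_of_nonneg_right (le_max_left _ _) hR)

theorem lopsided_iff_fewPrime_and_manyPrimeTail : LopsidedABC ↔ FewPrime ∧ ManyPrimeTail :=
  ⟨fun h => ⟨fewPrimeAt_of_lopsided h, manyPrimeTail_of_lopsided h⟩,
    fun h => lopsided_of_fewPrime_of_manyPrimeTail h.1 h.2⟩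

/-! ## §1 Min-breeding `τ(a,b,c) = (a², b(a+c), c²)` and the absorption theorem -/

/-- abc triples are symmetric in `a, b` (local copy of `IsABCTriple.swap`). [folklore] -/
theorem isABCTriple_swap {a b c : ℕ} (h : IsABCTriple a b c) : IsABCTriple b a c := by
  obtain ⟨ha, hb, habc, hcop⟩ := h
  exact ⟨hb, ha, by omega, hcop.symm⟩

/-- `rad(bac) = rad(abc)` (local copy of `rad_swap`). [folklore] -/
theorem rad_swap' (a b c : ℕ) : rad b a c = rad a b c := by
  rw [rad_def, rad_def, mul_comm b a]

/-- One min-breeding step on an (ordered) triple. -/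
def breed (t : ℕ × ℕ × ℕ) : ℕ × ℕ × ℕ := (t.1 ^ 2, t.2.1 * (t.1 + t.2.2), t.2.2 ^ 2)

/-- `i + 1` min-breeding steps. -/
def breedIter (t : ℕ × ℕ × ℕ) : ℕ → ℕ × ℕ × ℕ
  | 0 => breed t
  | i + 1 => breed (breedIter t i)

@[simp] theorem breed_fst (a b c : ℕ) : (breed (a, b, c)).1 = a ^ 2 := rfl
@[simp] theorem breed_snd (a b c : ℕ) : (breed (a, b, c)).2.1 = b * (a + c) := rfl
@[simp] theorem breed_thd (a b c : ℕ) : (breed (a, b, c)).2.2 = c ^ 2 := rfl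

/-- Min-breeding preserves abc triples: `a² + b(a+c) = c²`, `gcd(a², b(a+c)) = 1`. [folklore] -/
theorem isABCTriple_breed {a b c : ℕ} (h : IsABCTriple a b c) :
    IsABCTriple (a ^ 2) (b * (a + c)) (c ^ 2) := by
  obtain ⟨ha, hb, habc, hcop⟩ := h
  subst habc
  refine ⟨pow_pos ha 2, Nat.mul_pos hb (by omega), by ring, ?_⟩
  have h1 : Nat.Coprime a (a + (a + b)) :=
    Nat.coprime_self_add_right.mpr (Nat.coprime_self_add_right.mpr hcop)
  exact (Nat.Coprime.mul_right hcop h1).pow_left 2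

/-- The bred minimum stays the minimum: `a ≤ b → a² ≤ b(a+c)`. [folklore] -/
theorem breed_min_le {a b c : ℕ} (hab : a ≤ b) : a ^ 2 ≤ b * (a + c) := by
  rw [pow_two]; exact Nat.mul_le_mul hab (Nat.le_add_right a c)

/-- A sum of two coprime squares exceeding `2` has an odd prime factor (it is `≡ 1, 2 (mod 4)`).
[folklore] -/
theorem exists_odd_prime_dvd_sq_add_sq {x y : ℕ} (hcop : Nat.Coprime x y) (h2 : 2 < x ^ 2 + y ^ 2) :
    ∃ p : ℕ, p.Prime ∧ p ∣ x ^ 2 + y ^ 2 ∧ Odd p := by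
  rcases Nat.four_dvd_or_exists_odd_prime_and_dvd_of_two_lt h2 with h4 | h
  · exfalso
    obtain ⟨s, rfl | rfl⟩ := Nat.even_or_odd' x <;> obtain ⟨t, rfl | rfl⟩ := Nat.even_or_odd' y
    · have hg : 2 ∣ Nat.gcd (2 * s) (2 * t) := Nat.dvd_gcd ⟨s, rfl⟩ ⟨t, rfl⟩
      rw [Nat.Coprime.gcd_eq_one hcop] at hg
      omega
    · have e : (2 * s) ^ 2 + (2 * t + 1) ^ 2 = 4 * (s ^ 2 + t ^ 2 + t) + 1 := by ring
      rw [e] at h4; omega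
    · have e : (2 * s + 1) ^ 2 + (2 * t) ^ 2 = 4 * (s ^ 2 + s + t ^ 2) + 1 := by ring
      rw [e] at h4; omega
    · have e : (2 * s + 1) ^ 2 + (2 * t + 1) ^ 2 = 4 * (s ^ 2 + s + t ^ 2 + t) + 2 := by ring
      rw [e] at h4; omega
  · exact h


/-- In an abc triple, `a` and `c` are coprime. [folklore] -/
theorem coprime_a_c {a b c : ℕ} (h : IsABCTriple a b c) : Nat.Coprime a c := by
  obtain ⟨-, -, habc, hcop⟩ := h
  subst habc
  exact Nat.coprime_self_add_right.mpr hcop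

/-- **The new prime.** If `a = x²`, `c = z²` with `x, z` coprime and `z ≥ 2`, and `a + b = c`, then
`ω(c·b) + 1 ≤ ω(c²·(b(a+c)))`: an odd prime of `a + c = x² + z²` divides neither `c` nor `b`. [folklore] -/
theorem card_primeFactors_breed {a b c x z : ℕ} (h : IsABCTriple a b c) (hax : a = x ^ 2)
    (hcz : c = z ^ 2) (hxz : Nat.Coprime x z) (hz : 2 ≤ z) :
    (c * b).primeFactors.card + 1 ≤ (c ^ 2 * (b * (a + c))).primeFactors.card := by
  obtain ⟨ha, hb, habc, hcop⟩ := h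
  have hc : 0 < c := by omega
  have h2 : 2 < x ^ 2 + z ^ 2 :=
    calc 2 < 2 * 2 := by norm_num
      _ ≤ z * z := Nat.mul_le_mul hz hz
      _ = z ^ 2 := (pow_two z).symm
      _ ≤ x ^ 2 + z ^ 2 := Nat.le_add_left _ _
  obtain ⟨p, hp, hpdvd, hpodd⟩ := exists_odd_prime_dvd_sq_add_sq hxz h2
  rw [← hax, ← hcz] at hpdvd
  -- `p ∤ c`: else `p ∣ a`, contradicting `gcd(a,c) = 1`
  have hac : Nat.Coprime a c := coprime_a_c ⟨ha, hb, habc, hcop⟩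
  have hpc : ¬ p ∣ c := by
    intro hpc
    have hpa : p ∣ a := (Nat.dvd_add_left hpc).mp hpdvd
    exact hp.one_lt.ne' (Nat.eq_one_of_dvd_coprimes hac hpa hpc)
  -- `p ∤ b`: else `p ∣ b + (a + c) = 2c`, and `p` odd gives `p ∣ c`
  have hpb : ¬ p ∣ b := by
    intro hpb
    have h2c : p ∣ 2 * c := by
      have : b + (a + c) = 2 * c := by omega
      rw [← this]; exact dvd_add hpb hpdvd
    have hp2 : Nat.Coprime p 2 := (Nat.coprime_primes hp Nat.prime_two).mpr (by
      rintro rfl; exact (Nat.not_even_iff_odd.mpr hpodd) even_two)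
    exact hpc (hp2.dvd_of_dvd_mul_left h2c)
  have hnew0 : c ^ 2 * (b * (a + c)) ≠ 0 := by positivity
  have hsub : (c * b).primeFactors ⊆ (c ^ 2 * (b * (a + c))).primeFactors := by
    intro q hq
    rw [Nat.mem_primeFactors] at hq ⊢
    refine ⟨hq.1, ?_, hnew0⟩
    have : c * b ∣ c ^ 2 * (b * (a + c)) := ⟨c * (a + c), by ring⟩
    exact hq.2.1.trans this
  have hpmem : p ∈ (c ^ 2 * (b * (a + c))).primeFactors := by
    rw [Nat.mem_primeFactors]
    exact ⟨hp, Dvd.dvd.mul_left (Dvd.dvd.mul_left hpdvd b) _, hnew0⟩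
  have hpnot : p ∉ (c * b).primeFactors := by
    intro hmem
    have := Nat.dvd_of_mem_primeFactors hmem
    rcases (Nat.Prime.dvd_mul hp).mp this with h1 | h1
    · exact hpc h1
    · exact hpb h1
  calc (c * b).primeFactors.card + 1 = (insert p (c * b).primeFactors).card := by
        rw [Finset.card_insert_of_notMem hpnot]
    _ ≤ (c ^ 2 * (b * (a + c))).primeFactors.card :=
        Finset.card_le_card (Finset.insert_subset hpmem hsub)

/-- A product over a union of finsets of positive naturals is at most the product of the two
products. [folklore] -/
theorem prod_union_le {s t : Finset ℕ} (h : ∀ p ∈ s ∩ t, 0 < p) :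
    (∏ p ∈ s ∪ t, p) ≤ (∏ p ∈ s, p) * ∏ p ∈ t, p := by
  rw [← Finset.prod_union_inter]
  exact Nat.le_mul_of_pos_right _ (Finset.prod_pos h)

/-- **Breeding, radical**: `rad(a² · b(a+c) · c²) ≤ rad(abc) · (a + c)`. [folklore] -/
theorem rad_breed_le {a b c : ℕ} (h : IsABCTriple a b c) :
    rad (a ^ 2) (b * (a + c)) (c ^ 2) ≤ rad a b c * (a + c) := by
  obtain ⟨ha, hb, habc, hcop⟩ := h
  have hc : 0 < c := by omega
  have ha0 : a ≠ 0 := ha.ne'; have hb0 : b ≠ 0 := hb.ne'; have hc0 : c ≠ 0 := hc.ne'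
  have hs0 : a + c ≠ 0 := by omega
  rw [rad_def, rad_def, Nat.radical_eq_prod_primeFactors, Nat.radical_eq_prod_primeFactors]
  have hkey : (a ^ 2 * (b * (a + c)) * c ^ 2).primeFactors =
      (a * b * c).primeFactors ∪ (a + c).primeFactors := by
    rw [Nat.primeFactors_mul (by positivity) (by positivity),
      Nat.primeFactors_mul (by positivity) (by positivity), Nat.primeFactors_mul hb0 hs0,
      Nat.primeFactors_pow _ (by norm_num), Nat.primeFactors_pow _ (by norm_num),
      Nat.primeFactors_mul (by positivity) hc0, Nat.primeFactors_mul ha0 hb0]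
    ext p
    simp only [Finset.mem_union]
    tauto
  rw [hkey]
  calc (∏ p ∈ (a * b * c).primeFactors ∪ (a + c).primeFactors, p)
      ≤ (∏ p ∈ (a * b * c).primeFactors, p) * ∏ p ∈ (a + c).primeFactors, p :=
        prod_union_le (fun p hp => (Nat.prime_of_mem_primeFactors (Finset.mem_inter.mp hp).1).pos)
    _ ≤ (∏ p ∈ (a * b * c).primeFactors, p) * (a + c) := by
        apply Nat.mul_le_mul_left
        calc (∏ p ∈ (a + c).primeFactors, p) = radical (a + c) :=
              (Nat.radical_eq_prod_primeFactors).symm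
          _ ≤ a + c := Nat.radical_le_self_iff.mpr hs0

/-- **The iterated breeding, all invariants at once.** After `i + 1` min-breedings of an ordered abc
triple `(a ≤ b, c)`: the triple is `(a^(2^(i+1)), B, c^(2^(i+1)))`, abc, still ordered,
`ω(c'·B) ≥ i + 1`, and `rad ≤ rad(abc) · 2^(i+1) · c^(2^(i+1) − 1)`. [folklore] -/
theorem breedIter_spec {a b c : ℕ} (h : IsABCTriple a b c) (hab : a ≤ b) (i : ℕ) :
    (breedIter (a, b, c) i).1 = a ^ 2 ^ (i + 1) ∧
    (breedIter (a, b, c) i).2.2 = c ^ 2 ^ (i + 1) ∧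
    IsABCTriple (breedIter (a, b, c) i).1 (breedIter (a, b, c) i).2.1 (breedIter (a, b, c) i).2.2 ∧
    (breedIter (a, b, c) i).1 ≤ (breedIter (a, b, c) i).2.1 ∧
    i + 1 ≤ ((breedIter (a, b, c) i).2.2 * (breedIter (a, b, c) i).2.1).primeFactors.card ∧
    rad (breedIter (a, b, c) i).1 (breedIter (a, b, c) i).2.1 (breedIter (a, b, c) i).2.2 ≤
      rad a b c * (2 ^ (i + 1) * c ^ (2 ^ (i + 1) - 1)) := by
  have hc2 : 2 ≤ c := by obtain ⟨ha, hb, habc, -⟩ := h; omega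
  have hac : Nat.Coprime a c := coprime_a_c h
  induction i with
  | zero =>
    show (breed (a, b, c)).1 = _ ∧ (breed (a, b, c)).2.2 = _ ∧
      IsABCTriple (breed (a, b, c)).1 (breed (a, b, c)).2.1 (breed (a, b, c)).2.2 ∧
      (breed (a, b, c)).1 ≤ (breed (a, b, c)).2.1 ∧
      0 + 1 ≤ ((breed (a, b, c)).2.2 * (breed (a, b, c)).2.1).primeFactors.card ∧
      rad (breed (a, b, c)).1 (breed (a, b, c)).2.1 (breed (a, b, c)).2.2 ≤
        rad a b c * (2 ^ (0 + 1) * c ^ (2 ^ (0 + 1) - 1))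
    simp only [breed_fst, breed_snd, breed_thd]
    refine ⟨by norm_num, by norm_num, isABCTriple_breed h, breed_min_le hab, ?_, ?_⟩
    · rw [zero_add, Nat.succ_le_iff, Finset.card_pos, Nat.nonempty_primeFactors]
      obtain ⟨ha, hb, habc, -⟩ := h
      have : 1 < c ^ 2 := by nlinarith
      calc 1 < c ^ 2 := this
        _ = c ^ 2 * 1 := (mul_one _).symm
        _ ≤ c ^ 2 * (b * (a + c)) := Nat.mul_le_mul_left _ (Nat.mul_pos hb (by omega))
    · have hsimp : 2 ^ (0 + 1) * c ^ (2 ^ (0 + 1) - 1) = 2 * c := by norm_num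
      rw [hsimp]
      calc rad (a ^ 2) (b * (a + c)) (c ^ 2) ≤ rad a b c * (a + c) := rad_breed_le h
        _ ≤ rad a b c * (2 * c) := by
            apply Nat.mul_le_mul_left
            obtain ⟨ha, hb, habc, -⟩ := h
            omega
  | succ i ih =>
    obtain ⟨h1, h3, habc', hle, hω, hrad⟩ := ih
    -- name the current triple
    set A := (breedIter (a, b, c) i).1 with hA
    set B := (breedIter (a, b, c) i).2.1 with hB
    set C := (breedIter (a, b, c) i).2.2 with hC
    have hnext : breedIter (a, b, c) (i + 1) = breed (A, B, C) := by
      show breed (breedIter (a, b, c) i) = _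
      rfl
    rw [hnext]
    simp only [breed_fst, breed_snd, breed_thd]
    have hpow : ∀ n : ℕ, (n ^ 2 ^ (i + 1)) ^ 2 = n ^ 2 ^ (i + 1 + 1) := by
      intro n; rw [← pow_mul, ← pow_succ]
    refine ⟨by rw [h1, hpow], by rw [h3, hpow], isABCTriple_breed habc', breed_min_le hle, ?_, ?_⟩
    · -- the new odd prime of `A + C = (a^(2^i))² + (c^(2^i))²`
      have hAx : A = (a ^ 2 ^ i) ^ 2 := by rw [h1, ← pow_mul, ← pow_succ]
      have hCz : C = (c ^ 2 ^ i) ^ 2 := by rw [h3, ← pow_mul, ← pow_succ]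
      have hxz : Nat.Coprime (a ^ 2 ^ i) (c ^ 2 ^ i) := Nat.Coprime.pow _ _ hac
      have hz : 2 ≤ c ^ 2 ^ i :=
        le_trans hc2 (Nat.le_self_pow (Nat.pos_iff_ne_zero.mp (Nat.two_pow_pos i)) c)
      have := card_primeFactors_breed habc' hAx hCz hxz hz
      omega
    · -- radical bookkeeping: `rad' ≤ rad · (A + C) ≤ rad · 2C`, `C = c^(2^(i+1))`
      have habc'' := habc'
      obtain ⟨hApos, -, hsum, -⟩ := habc'
      have hAC : A + C ≤ 2 * C := by omega
      have hP : 1 ≤ 2 ^ (i + 1) := Nat.one_le_two_pow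
      have hexp : 2 ^ (i + 1) - 1 + 2 ^ (i + 1) = 2 ^ (i + 1 + 1) - 1 := by
        have : 2 ^ (i + 1 + 1) = 2 ^ (i + 1) + 2 ^ (i + 1) := by ring
        omega
      calc rad (A ^ 2) (B * (A + C)) (C ^ 2)
          ≤ rad A B C * (A + C) := rad_breed_le habc''
        _ ≤ rad a b c * (2 ^ (i + 1) * c ^ (2 ^ (i + 1) - 1)) * (2 * C) :=
            Nat.mul_le_mul hrad hAC
        _ = rad a b c * (2 ^ (i + 1 + 1) * c ^ (2 ^ (i + 1 + 1) - 1)) := by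
            rw [h3, ← hexp, pow_add c (2 ^ (i + 1) - 1) (2 ^ (i + 1))]
            ring

/-- **Real-exponent bookkeeping**: from `c^(D+1) < K·(R·(T·c^D))^(1+η)` with `0 < 1 − Dη` deduce
`c < (K·T^(1+η))^(1/(1−Dη)) · R^((1+η)/(1−Dη))`. [folklore] -/
theorem lt_of_breed_bound {K R c η D T : ℝ} (hK : 0 < K) (hR : 1 ≤ R) (hc : 1 ≤ c) (hT : 0 < T)
    (_hD : 0 ≤ D) (hθ : 0 < 1 - D * η) (_hη : 0 < η)
    (h : c ^ (D + 1) < K * (R * (T * c ^ D)) ^ (1 + η)) :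
    c < (K * T ^ (1 + η)) ^ (1 / (1 - D * η)) * R ^ ((1 + η) * (1 / (1 - D * η))) := by
  have hc0 : 0 < c := (by linarith); have hR0 : 0 < R := by linarith
  have ht' : 0 < 1 / (1 - D * η) := by positivity
  have hexp : (R * (T * c ^ D)) ^ (1 + η) = R ^ (1 + η) * T ^ (1 + η) * c ^ (D * (1 + η)) := by
    rw [Real.mul_rpow hR0.le (by positivity), Real.mul_rpow hT.le (by positivity),
      ← Real.rpow_mul hc0.le]
    ring
  rw [hexp] at h
  have hcpow : 0 < c ^ (D * (1 + η)) := Real.rpow_pos_of_pos hc0 _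
  have h2 : c ^ (D + 1) / c ^ (D * (1 + η)) < K * T ^ (1 + η) * R ^ (1 + η) := by
    rw [div_lt_iff₀ hcpow]
    calc c ^ (D + 1) < K * (R ^ (1 + η) * T ^ (1 + η) * c ^ (D * (1 + η))) := h
      _ = K * T ^ (1 + η) * R ^ (1 + η) * c ^ (D * (1 + η)) := by ring
  rw [← Real.rpow_sub hc0] at h2
  have hsub : D + 1 - D * (1 + η) = 1 - D * η := by ring
  rw [hsub] at h2
  have hlhs : 0 ≤ c ^ (1 - D * η) := (Real.rpow_pos_of_pos hc0 _).le
  have h3 := Real.rpow_lt_rpow hlhs h2 ht'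
  rw [← Real.rpow_mul hc0.le, show (1 - D * η) * (1 / (1 - D * η)) = 1 by field_simp,
    Real.rpow_one] at h3
  calc c < (K * T ^ (1 + η) * R ^ (1 + η)) ^ (1 / (1 - D * η)) := h3
    _ = (K * T ^ (1 + η)) ^ (1 / (1 - D * η)) * R ^ ((1 + η) * (1 / (1 - D * η))) := by
        rw [Real.mul_rpow (by positivity) (by positivity), Real.rpow_mul hR0.le]

/-- **ABSORPTION THEOREM.** For every FIXED threshold `k`, lopsided abc on the cell
`ω(c·max(a,b)) > k` already implies the whole crux `LopsidedABC`: breed the minimum `k + 1` times.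
Consequently the registered stub `stub_manyPrimeCoincidence` (`∃ k, ManyPrimeAt k`) is EQUIVALENT to the
crux and `stub_fewPrimeCoincidence` is not load-bearing in the birth skeleton. [folklore] -/
theorem lopsided_of_manyPrimeAt (k : ℕ) (hk : ManyPrimeAt k) : LopsidedABC := by
  intro ε hε
  -- parameters of the bookkeeping (`D = 2^(k+1) − 1`, `T = 2^(k+1)`, `η = ε/(1+(1+ε)D)`)
  set D : ℝ := (2 : ℝ) ^ (k + 1) - 1 with hDdef
  have hD : 0 ≤ D := by
    have : (1 : ℝ) ≤ (2 : ℝ) ^ (k + 1) := one_le_pow₀ (by norm_num)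
    rw [hDdef]; linarith
  set η : ℝ := ε / (1 + (1 + ε) * D) with hηdef
  have hden : 0 < 1 + (1 + ε) * D := by positivity
  have hη : 0 < η := by positivity
  have hηε : η ≤ ε := by
    rw [hηdef, div_le_iff₀ hden]
    have h0 : 0 ≤ ε * ((1 + ε) * D) := by positivity
    nlinarith [h0]
  have hθ' : 1 - D * η = (1 + η) / (1 + ε) := by
    rw [hηdef]; field_simp; ring
  have hθ : 0 < 1 - D * η := by rw [hθ']; positivity
  have hθ_eq : (1 + η) * (1 / (1 - D * η)) = 1 + ε := by
    rw [hθ']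
    have : 0 < 1 + η := by linarith
    field_simp
  obtain ⟨K, hK, hKb⟩ := hk η hη
  set T : ℝ := (2 : ℝ) ^ (k + 1) with hTdef
  have hT : 0 < T := by positivity
  refine ⟨(K * T ^ (1 + η)) ^ (1 / (1 - D * η)), Real.rpow_pos_of_pos (by positivity) _, ?_⟩
  intro a b c habc hlop
  -- WLOG `a ≤ b`
  wlog hab : a ≤ b generalizing a b with H
  · have := H b a (isABCTriple_swap habc) (by rwa [min_comm]) (not_le.mp hab).le
    rwa [rad_swap'] at this
  -- the core: breed `k + 1` times
  obtain ⟨h1, h3, habc', hle, hω, hrad⟩ := breedIter_spec habc hab k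
  set A := (breedIter (a, b, c) k).1
  set B := (breedIter (a, b, c) k).2.1
  set C := (breedIter (a, b, c) k).2.2
  obtain ⟨ha, hb, hsum, hcop⟩ := habc
  have hc1 : (1 : ℝ) ≤ c := by exact_mod_cast (show 1 ≤ c by omega)
  have hc0 : (0 : ℝ) < c := by linarith
  have hmin : min a b = a := min_eq_left hab
  rw [hmin] at hlop
  -- the bred triple is in the many-prime cell
  have hcell : k < (C * max A B).primeFactors.card := by
    rw [max_eq_right hle]; omega
  -- and it is lopsided at scale `η`
  have hM0 : (0 : ℝ) ≤ ((2 ^ (k + 1) : ℕ) : ℝ) := Nat.cast_nonneg _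
  have hlop' : ((min A B : ℕ) : ℝ) ≤ (C : ℝ) ^ (1 - η) := by
    rw [min_eq_left hle, h1, h3]
    push_cast
    have ha0 : (0 : ℝ) ≤ a := Nat.cast_nonneg a
    calc (a : ℝ) ^ (2 ^ (k + 1)) ≤ ((c : ℝ) ^ (1 - ε)) ^ (2 ^ (k + 1)) :=
          pow_le_pow_left₀ ha0 hlop _
      _ = (c : ℝ) ^ ((1 - ε) * ((2 ^ (k + 1) : ℕ) : ℝ)) := by
          rw [Real.rpow_mul hc0.le, Real.rpow_natCast]
      _ ≤ (c : ℝ) ^ ((1 - η) * ((2 ^ (k + 1) : ℕ) : ℝ)) := by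
          apply Real.rpow_le_rpow_of_exponent_le hc1
          exact mul_le_mul_of_nonneg_right (by linarith) hM0
      _ = ((c : ℝ) ^ (2 ^ (k + 1))) ^ (1 - η) := by
          rw [mul_comm, Real.rpow_mul hc0.le, Real.rpow_natCast]
  have hlt := hKb A B C habc' hcell hlop'
  -- radical and size bookkeeping
  have hR1 : (1 : ℝ) ≤ (rad a b c : ℕ) := by
    have : 0 < rad a b c := by rw [rad_def]; exact Nat.pos_of_ne_zero radical_ne_zero
    exact_mod_cast this
  have hDcast : ((2 ^ (k + 1) - 1 : ℕ) : ℝ) = D := by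
    rw [hDdef, Nat.cast_sub Nat.one_le_two_pow]; push_cast; ring
  have hD1cast : ((2 ^ (k + 1) : ℕ) : ℝ) = D + 1 := by
    rw [hDdef]; push_cast; ring
  have hradle : ((rad A B C : ℕ) : ℝ) ≤ (rad a b c : ℕ) * (T * (c : ℝ) ^ D) := by
    have hcast : ((rad a b c * (2 ^ (k + 1) * c ^ (2 ^ (k + 1) - 1)) : ℕ) : ℝ) =
        (rad a b c : ℕ) * (T * (c : ℝ) ^ D) := by
      rw [Nat.cast_mul, Nat.cast_mul, Nat.cast_pow c, ← Real.rpow_natCast (c : ℝ) (2 ^ (k + 1) - 1),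
        hDcast, hTdef]
      push_cast
      ring
    rw [← hcast]
    exact_mod_cast hrad
  have h1η : 0 ≤ 1 + η := by linarith
  have hstep : (c : ℝ) ^ (D + 1) < K * (((rad a b c : ℕ) : ℝ) * (T * (c : ℝ) ^ D)) ^ (1 + η) := by
    have hcast : ((C : ℕ) : ℝ) = (c : ℝ) ^ (D + 1) := by
      rw [h3, Nat.cast_pow, ← Real.rpow_natCast (c : ℝ) (2 ^ (k + 1)), hD1cast]
    rw [← hcast]
    refine hlt.trans_le ?_
    apply mul_le_mul_of_nonneg_left _ hK.le
    exact Real.rpow_le_rpow (Nat.cast_nonneg _) hradle h1η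
  have := lt_of_breed_bound hK hR1 hc1 hT hD hθ hη hstep
  rwa [hθ_eq] at this

/-- `∃ k, ManyPrimeAt k` is, up to unfolding, the registered statement of `stub_manyPrimeCoincidence`;
it is EQUIVALENT to the crux. [folklore] -/
theorem registeredStubMany_iff_crux :
    (∃ k : ℕ, ∀ ε : ℝ, 0 < ε → ∃ K : ℝ, 0 < K ∧ ∀ a b c : ℕ, IsABCTriple a b c →
      k < (c * max a b).primeFactors.card → ((min a b : ℕ) : ℝ) ≤ (c : ℝ) ^ (1 - ε) →
      (c : ℝ) < K * ((rad a b c : ℕ) : ℝ) ^ (1 + ε)) ↔ LopsidedABC :=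
  ⟨fun ⟨k, hk⟩ => lopsided_of_manyPrimeAt k hk, fun h => ⟨0, manyPrimeAt_of_lopsided h 0⟩⟩

/-- Each fixed-threshold many-prime cell is crux-complete. [folklore] -/
theorem manyPrimeAt_iff_crux (k : ℕ) : ManyPrimeAt k ↔ LopsidedABC :=
  ⟨lopsided_of_manyPrimeAt k, fun h => manyPrimeAt_of_lopsided h k⟩

/-! ## §3 The `c`-dominance split (census D3) -/

/-- Lopsided abc on the `c`-DOMINATED cell: one prime power of `c` carries `c^(1-ε)`. -/
def CDominated : Prop :=
  ∀ ε : ℝ, 0 < ε → ∃ K : ℝ, 0 < K ∧ ∀ a b c : ℕ, IsABCTriple a b c →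
    (∃ p : ℕ, p.Prime ∧ (c : ℝ) ^ (1 - ε) ≤ ((p ^ c.factorization p : ℕ) : ℝ)) →
    ((min a b : ℕ) : ℝ) ≤ (c : ℝ) ^ (1 - ε) → (c : ℝ) < K * ((rad a b c : ℕ) : ℝ) ^ (1 + ε)

/-- Lopsided abc on the `c`-DISPERSED cell: no prime power of `c` reaches `c^(1-ε)`. -/
def CDispersed : Prop :=
  ∀ ε : ℝ, 0 < ε → ∃ K : ℝ, 0 < K ∧ ∀ a b c : ℕ, IsABCTriple a b c →
    (∀ p : ℕ, p.Prime → ((p ^ c.factorization p : ℕ) : ℝ) < (c : ℝ) ^ (1 - ε)) →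
    ((min a b : ℕ) : ℝ) ≤ (c : ℝ) ^ (1 - ε) → (c : ℝ) < K * ((rad a b c : ℕ) : ℝ) ^ (1 + ε)

theorem cDominated_of_lopsided (h : LopsidedABC) : CDominated := by
  intro ε hε
  obtain ⟨K, hK, hh⟩ := h ε hε
  exact ⟨K, hK, fun a b c habc _ hlop => hh a b c habc hlop⟩

theorem cDispersed_of_lopsided (h : LopsidedABC) : CDispersed := by
  intro ε hε
  obtain ⟨K, hK, hh⟩ := h ε hε
  exact ⟨K, hK, fun a b c habc _ hlop => hh a b c habc hlop⟩

/-- Assembly of D3 (a partition at the same `ε`; `K := max K₁ K₂`). [folklore] -/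
theorem lopsided_of_cDominated_of_cDispersed (hdom : CDominated) (hdisp : CDispersed) :
    LopsidedABC := by
  intro ε hε
  obtain ⟨K₁, hK₁, h₁⟩ := hdom ε hε
  obtain ⟨K₂, hK₂, h₂⟩ := hdisp ε hε
  refine ⟨max K₁ K₂, lt_max_of_lt_left hK₁, fun a b c habc hlop => ?_⟩
  have hR : 0 ≤ ((rad a b c : ℕ) : ℝ) ^ (1 + ε) := by positivity
  by_cases hcase : ∃ p : ℕ, p.Prime ∧ (c : ℝ) ^ (1 - ε) ≤ ((p ^ c.factorization p : ℕ) : ℝ)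
  · exact (h₁ a b c habc hcase hlop).trans_le (mul_le_mul_of_nonneg_right (le_max_left _ _) hR)
  · push Not at hcase
    exact (h₂ a b c habc hcase hlop).trans_le (mul_le_mul_of_nonneg_right (le_max_right _ _) hR)

theorem lopsided_iff_cDominated_and_cDispersed : LopsidedABC ↔ CDominated ∧ CDispersed :=
  ⟨fun h => ⟨cDominated_of_lopsided h, cDispersed_of_lopsided h⟩,
    fun h => lopsided_of_cDominated_of_cDispersed h.1 h.2⟩

end Summit.ABC.ABC.Cruxes.LopsidedABC.Strategist
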